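import Literature.MathematicalPhysics.StatisticalMechanics.ComplexSpinTwoPointFourier
import Literature.MathematicalPhysics.StatisticalMechanics.ComplexSpinThermodynamicLimit
import Literature.MathematicalPhysics.StatisticalMechanics.ComplexSpinFluctuationFiveSixCertificate
import HarnessLib

/-!
# Thermodynamic limits of the two-point function: Salmhofer–Seiler's Theorem 3.23 (1) and chiral
# long-range order in the infinite volume (CMP 139 (1991), Thm. 3.23 (1), Thm. 4.8 (4.42),
# Cor. 4.9, Remark 4.10 (1) (4.43))

Theorems only (no definition, no named fact).  The tree proves Salmhofer–Seiler's chiral long-range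
order in its uniform FINITE-VOLUME form (`chiralLRO_expect_limit`, `uN_chiralLRO_of_four_le`:
`|Λ|⁻¹∑_x⟨σ₀σ_x⟩_Λ ≥ c > 0` on all large even tori).  The printed statements are about the
THERMODYNAMIC LIMIT: Thm. 3.23 (1) says that any limit `T̂ = lim T̂_Λ` of the Fourier transforms of
the two-point function is a signed measure `c₀δ₀ - c_π̂δ_π̂ + ĝ` with `c₀, c_π̂ ≥ 0` and `ĝ`
absolutely continuous, and Thm. 4.8 / Remark 4.10 (1) conclude
`lim_{|x|→∞, ε(x)=-1} ⟨ψ̄ψ(0)ψ̄ψ(x)⟩/(2N)² = limsup_x ⟨ψ̄ψ(0)ψ̄ψ(x)⟩/(2N)² = 2c₀ > 0` (4.43).  This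
file proves these statements in lattice form, for pointwise limits `T(x) = lim_n T_{Λ_n}(x)` along
even tori `Λ_n = (ℤ/L_n)^ν`, `L_n → ∞` (the limits whose existence along subsequences is Thm. 3.18 (2),
`exists_subseq_tendsto_expect`):

* **`thermodynamicLimit_twoPoint_decomp`** (Thm. 3.23 (1)): for `ν ≥ 3`, `b_k ≥ 0` (Thm. 3.21's
  hypothesis) and `|T_Λ| ≤ 1`, there are `c₀ ≥ 0`, `c_π̂ ≥ 0` with `|Λ_n|⁻¹T̂_{Λ_n}(0) → c₀`,
  `|Λ_n|⁻¹T̂_{Λ_n}(π̂) → -c_π̂` (the whole sequence, not a subsequence) and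
  `T(x) - (c₀ - c_π̂ ε(x)) → 0` as `|x| → ∞` — i.e. `T = ` (Fourier transform of the two Dirac
  masses) `+` (a function vanishing at infinity); `…_of_hasLog`: the same under Thm. 3.18's
  hypotheses (`B = exp(NW)`, `w₁ = 1`, `w_k ≥ 0`, `m ≥ 0`);
* **`chiralLRO_thermodynamicLimit`** (Thm. 4.8 (4.42), Remark 4.10 (1) (4.43)): at `m = 0`,
  `c_π̂ = c₀ ≥ (1/4ν)(1/K(N) - 2S(ν)/N)`, `T = 0` on the even sublattice, `T(x) → 2c₀` along the odd
  sublattice, `limsup_x T(x) = 2c₀`;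
* **`uN_chiralLRO_thermodynamicLimit`**, **`uN_chiralLRO_infiniteVolume`** (Cor. 4.9 with
  Remark 4.10 (1), `1 ≤ N ≤ 4`, `ν ≥ 4`, no numerical hypothesis — the computer-assisted
  `S(ν) < 0.35` is the tree's kernel certificate): `2c₀ > 0`, for EVERY thermodynamic limit, and
  such limits exist along a subsequence of any sequence of even tori (`exists_subseq_tendsto_corrFn`).

METHOD (replacing the Riesz–Markov / peaking-argument road of the print, same input (3.113)).  By
`ComplexSpinTwoPointFourier`, `T_Λ = a_Λ + b_Λε + (near) + (far)` with `|near| ≤ n_Λ(η)`,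
`∑_x|far|² ≤ (2Nη)⁻²` uniformly in `Λ`, `n_Λ(η) → n(η)` and `n(η) → 0` (`η → 0`).  Along a
subsequence the bounded atoms converge, `a → c`, `b → c'`; on every finite set of sites the bound
`∑((|T_Λ - a_Λ - b_Λε| - n_Λ)⁺)² ≤ (2Nη)⁻²` passes to the limit, so `{x : |T(x) - c - c'ε(x)| >
n(η) + δ}` is finite for every `δ > 0`: the regular part tends to `0` at infinity.  Testing against
the two infinite sublattices shows that `(c, c')` is determined by `T`, hence the atoms converge
along the whole sequence; their signs are (3.112) at `k = 0`, `k = π̂` (`neg_le_zeroMode`,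
`stagMode_le`).  At `m = 0`, (3.101)/(3.106) give `T|_{even} = 0`, `c' = -c`, and (4.42) is the
limit of the tree's finite-volume `chiralLRO_expect_limit`.  Honest framing: `β = 0` complex spin
systems on even tori and their pointwise thermodynamic limits; nothing about `β > 0`, the continuum,
`SU(N)` or the summit's `QCD` conjunct; the identification with the `U(N)` gauge theory is
`StrongCouplingBosonisation` (Salmhofer–Seiler §2).

WHAT IS PRINTED (locators).  Thm. 3.23 (1) p. 415 ("Any thermodynamic limit of the two-point
function `T̂ = lim_{Λ→∞} T̂_Λ` is a signed measure on `ℬ_ν = [-π,π]^ν`.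
`T̂(k) = c₀δ(k) - c_π̂δ(k-π̂) + ĝ(k)` with `c₀ ≥ 0`, `c_π̂ ≥ 0` (`c₀ = c_π̂` at `m = 0`), `ĝ`
absolutely continuous with respect to Lebesgue measure, and (3.109)"); Thm. 4.8 with (4.40)–(4.42)
pp. 422–423; Cor. 4.9 p. 423; Remark 4.10 (1) (4.43) p. 423
("`limsup_{x∈ℤ^ν} (2N)^{-2}⟨ψ̄ψ(0)ψ̄ψ(x)⟩ = lim_{|x|→∞, ε(x)=-1} (2N)^{-2}⟨ψ̄ψ(0)ψ̄ψ(x)⟩ = 2c₀`").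

## References

* M. Salmhofer, E. Seiler, *Proof of chiral symmetry breaking in strongly coupled lattice gauge
  theory*, Commun. Math. Phys. 139 (1991) 395–432: Thm. 3.18 (2), Thm. 3.23, Thm. 4.8, Cor. 4.9,
  Remark 4.10. [SalmhoferSeiler1991]
* J. Fröhlich, B. Simon, T. Spencer, Commun. Math. Phys. 50 (1976) 79–95 (the paper's [18]).
  [FrohlichSimonSpencer1976]

## Mathlib

`tendsto_subseq_of_bounded` (Bolzano–Weierstrass in `ℝ × ℝ`), `tendsto_of_subseq_tendsto`,
`Filter.frequently_cofinite_iff_infinite`, `Set.Infinite.exists_subset_card_eq`,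
`Filter.limsup_le_of_le` / `Filter.le_limsup_of_frequently_le`.
-/

noncomputable section

namespace Literature.MathematicalPhysics.StatisticalMechanics

namespace ComplexSpin

open MvPolynomial Finset Filter MeasureTheory Topology
open Literature.Probability.LatticeModels

variable {ν : ℕ}

/-! ### Geometry of `ℤ^ν`: projections to large tori are injective on finite sets; both sublattices are infinite -/

/-- `Torus.proj L 0 = 0`. [folklore] -/
private theorem torus_proj_zero (L : ℕ) : Torus.proj L (0 : Site ν) = 0 := by
  funext i; simp [Torus.proj]

/-- Two sites of `ℤ^ν` with the same image on `(ℤ/L)^ν`, `L` larger than all their coordinates in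
absolute value twice over, are equal. [folklore] -/
private theorem eq_of_proj_eq {L : ℕ} {x y : Site ν} (hx : ∀ i, |x i| < L / 2) (hy : ∀ i, |y i| < L / 2)
    (h : Torus.proj L x = Torus.proj L y) : x = y := by
  funext i
  have hi : ((x i : ℤ) : ZMod L) = ((y i : ℤ) : ZMod L) := congrFun h i
  rw [ZMod.intCast_eq_intCast_iff_dvd_sub] at hi
  obtain ⟨k, hk⟩ := hi
  have hxi := hx i
  have hyi := hy i
  rw [abs_lt] at hxi hyi
  have hL2 : ((L / 2 : ℕ) : ℤ) ≤ (L : ℤ) / 2 := by omega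
  have hb : |y i - x i| < L := by
    rw [abs_lt]; constructor <;> omega
  rw [hk, abs_mul, Nat.abs_cast] at hb
  rcases eq_or_ne k 0 with hk0 | hk0
  · rw [hk0, mul_zero] at hk; omega
  · have : (L : ℤ) * 1 ≤ (L : ℤ) * |k| := by
      exact mul_le_mul_of_nonneg_left (Int.one_le_abs hk0) (by positivity)
    omega

/-- **The projection `ℤ^ν → (ℤ/L)^ν` is injective on any finite set for all large `L`.** [folklore] -/
private theorem exists_injOn_proj (B : Finset (Site ν)) :
    ∃ L₀ : ℕ, ∀ L : ℕ, L₀ ≤ L → Set.InjOn (Torus.proj L) (B : Set (Site ν)) := by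
  classical
  -- a bound on all coordinates of all points of `B`
  obtain ⟨M, hM⟩ : ∃ M : ℕ, ∀ x ∈ B, ∀ i, |x i| < M := by
    refine ⟨(B.sup fun x => Finset.univ.sup fun i => (x i).natAbs) + 1, fun x hx i => ?_⟩
    have h1 : (x i).natAbs ≤ Finset.univ.sup fun i => (x i).natAbs :=
      Finset.le_sup (f := fun i => (x i).natAbs) (Finset.mem_univ i)
    have h2 : (Finset.univ.sup fun i => (x i).natAbs) ≤ B.sup fun x => Finset.univ.sup fun i => (x i).natAbs :=
      Finset.le_sup (f := fun x => Finset.univ.sup fun i => (x i).natAbs) hx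
    have h3 : (x i).natAbs < (B.sup fun x => Finset.univ.sup fun i => (x i).natAbs) + 1 := by omega
    rw [Int.abs_eq_natAbs]
    exact_mod_cast h3
  refine ⟨2 * M + 2, fun L hL x hx y hy hxy => ?_⟩
  refine eq_of_proj_eq (L := L) (fun i => ?_) (fun i => ?_) hxy
  · have := hM x hx i
    have : (M : ℤ) ≤ ((L / 2 : ℕ) : ℤ) := by exact_mod_cast (by omega : M ≤ L / 2)
    omega
  · have := hM y hy i
    have : (M : ℤ) ≤ ((L / 2 : ℕ) : ℤ) := by exact_mod_cast (by omega : M ≤ L / 2)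
    omega

/-- The line `k ↦ (k, 0, …, 0)` in `ℤ^ν` is injective. [folklore] -/
private theorem single_axis_injective (hν : 1 ≤ ν) :
    Function.Injective fun k : ℤ => (Pi.single (⟨0, hν⟩ : Fin ν) k : Site ν) := by
  intro k k' h
  have := congrFun h ⟨0, hν⟩
  simpa using this

/-- `∑_μ (k e₀)_μ = k`. [folklore] -/
private theorem sum_single_axis (hν : 1 ≤ ν) (k : ℤ) :
    ∑ i, (Pi.single (⟨0, hν⟩ : Fin ν) k : Site ν) i = k := by
  rw [Finset.sum_eq_single (⟨0, hν⟩ : Fin ν)]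
  · simp
  · intro i _ hi; simp [Pi.single_eq_of_ne hi]
  · intro h; exact absurd (Finset.mem_univ _) h

/-- **Both sublattices of `ℤ^ν` are infinite** (`ν ≥ 1`): the even one … [folklore] -/
private theorem infinite_latSgn_eq_one (hν : 1 ≤ ν) : {x : Site ν | latSgn x = 1}.Infinite := by
  have hinj : Function.Injective fun k : ℤ => (Pi.single (⟨0, hν⟩ : Fin ν) (2 * k) : Site ν) :=
    fun k k' h => by simpa using single_axis_injective hν h
  refine Set.infinite_of_injective_forall_mem hinj fun k => ?_
  simp only [Set.mem_setOf_eq, latSgn, sum_single_axis, even_two_mul, if_true]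

/-- … and the odd one. [folklore] -/
private theorem infinite_latSgn_eq_neg_one (hν : 1 ≤ ν) : {x : Site ν | latSgn x = -1}.Infinite := by
  have hinj : Function.Injective fun k : ℤ => (Pi.single (⟨0, hν⟩ : Fin ν) (2 * k + 1) : Site ν) :=
    fun k k' h => by simpa using single_axis_injective hν h
  refine Set.infinite_of_injective_forall_mem hinj fun k => ?_
  simp only [Set.mem_setOf_eq, latSgn, sum_single_axis, Int.not_even_two_mul_add_one, if_false]

/-- `ℤ^ν` is infinite for `ν ≥ 1`. [folklore] -/
private theorem infinite_site (hν : 1 ≤ ν) : Infinite (Site ν) :=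
  Infinite.of_injective _ (single_axis_injective hν)

/-- A function `α + β ε(x)` on `ℤ^ν` tending to `0` at infinity vanishes identically: `α = β = 0`.
[cite: SalmhoferSeiler1991, Thm. 3.23 (1) (uniqueness of c₀, c_π̂)] -/
theorem eq_zero_of_tendsto_const_add_mul_latSgn (hν : 1 ≤ ν) {α β : ℝ}
    (h : Tendsto (fun x : Site ν => α + β * latSgn x) cofinite (nhds 0)) : α = 0 ∧ β = 0 := by
  have key : ∀ s : ℝ, {x : Site ν | latSgn x = s}.Infinite → α + β * s = 0 := by
    intro s hs
    have hfr : ∃ᶠ x in cofinite, latSgn x = s := frequently_cofinite_iff_infinite.2 hs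
    by_contra hne
    have hpos : 0 < |α + β * s| := abs_pos.2 hne
    have hev : ∀ᶠ x : Site ν in cofinite, |α + β * latSgn x - 0| < |α + β * s| :=
      (Metric.tendsto_nhds.1 h) _ hpos
    obtain ⟨x, hx1, hx2⟩ := (hfr.and_eventually hev).exists
    rw [hx1, sub_zero] at hx2
    exact lt_irrefl _ hx2
  have h1 := key 1 (infinite_latSgn_eq_one hν)
  have h2 := key (-1) (infinite_latSgn_eq_neg_one hν)
  constructor <;> linarith

/-! ### An `ℓ²` lemma: square-summable above a threshold ⇒ eventually below it (cofinite) -/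

/-- If `∑_{x ∈ B} ((|R(x)| - t)⁺)² ≤ C` for every finite `B ⊂ ℤ^ν`, then for every `δ > 0`,
`|R(x)| ≤ t + δ` for all but finitely many `x`. [folklore] -/
private theorem eventually_abs_le_of_sum_sq_le {R : Site ν → ℝ} {t C : ℝ}
    (h : ∀ B : Finset (Site ν), ∑ x ∈ B, (max (|R x| - t) 0) ^ 2 ≤ C) {δ : ℝ} (hδ : 0 < δ) :
    ∀ᶠ x in cofinite, |R x| ≤ t + δ := by
  rw [Filter.eventually_cofinite]
  by_contra hinf
  rw [Set.not_finite] at hinf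
  obtain ⟨n, hn⟩ := exists_nat_gt (C / δ ^ 2)
  obtain ⟨B, hBsub, hBcard⟩ := hinf.exists_subset_card_eq n
  have hC := h B
  have hlow : ∑ x ∈ B, (max (|R x| - t) 0) ^ 2 ≥ n * δ ^ 2 := by
    have : ∀ x ∈ B, δ ^ 2 ≤ (max (|R x| - t) 0) ^ 2 := by
      intro x hx
      have hx' : t + δ < |R x| := not_le.1 (hBsub hx)
      have : δ ≤ max (|R x| - t) 0 := le_max_of_le_left (by linarith)
      exact pow_le_pow_left₀ hδ.le this 2
    calc (n : ℝ) * δ ^ 2 = ∑ _x ∈ B, δ ^ 2 := by rw [Finset.sum_const, hBcard, nsmul_eq_mul]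
      _ ≤ ∑ x ∈ B, (max (|R x| - t) 0) ^ 2 := Finset.sum_le_sum this
  have : C / δ ^ 2 * δ ^ 2 = C := by field_simp
  nlinarith [mul_lt_mul_of_pos_right hn (pow_pos hδ 2)]

/-! ### Theorem 3.23 (1): the structure of every thermodynamic limit of the two-point function -/

section Limit

variable (Ls : ℕ → ℕ) [∀ n, NeZero (Ls n)]

/-- `|Λ_n| → ∞` along tori `Λ_n = (ℤ/L_n)^ν` with `L_n → ∞` (`ν ≥ 1`). [folklore] -/
private theorem tendsto_card_inv (hν : 1 ≤ ν) (hLs : Tendsto Ls atTop atTop) :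
    Tendsto (fun n => (Fintype.card (TorusSite ν (Ls n)) : ℝ)⁻¹) atTop (nhds 0) := by
  have h1 : Tendsto (fun n => (Fintype.card (TorusSite ν (Ls n)) : ℝ)) atTop atTop := by
    refine tendsto_atTop_mono (fun n => ?_) (tendsto_natCast_atTop_atTop.comp hLs)
    rw [Function.comp_apply, card_torusSite]
    push_cast
    calc ((Ls n : ℕ) : ℝ) = ((Ls n : ℕ) : ℝ) ^ 1 := (pow_one _).symm
      _ ≤ ((Ls n : ℕ) : ℝ) ^ ν :=
          pow_le_pow_right₀ (by exact_mod_cast Nat.one_le_iff_ne_zero.2 (NeZero.ne _)) hν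
  exact tendsto_inv_atTop_zero.comp h1

/-- **The core of Thm. 3.23 (1)**: if along even tori `Λ_n → ∞` the two-point functions converge
pointwise to `T` and the two atoms converge, `a_{Λ_n} → c`, `b_{Λ_n} → c'`, then the regular part
`T(x) - c - c' ε(x)` tends to `0` as `|x| → ∞` — the lattice form of "`ĝ` is absolutely continuous"
(its Fourier transform vanishes at infinity).  Proof: the finite-volume remainders are, up to the
near bound `n_Λ(η) → n(η)`, square-summable uniformly in `Λ` by `(2Nη)⁻²` (Parseval + (3.113)), this
passes to the limit on every finite set of sites, and `n(η) → 0` as `η → 0` because `b ∈ L¹`.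
[cite: SalmhoferSeiler1991, Thm. 3.23 (1), proof (3.112)–(3.119)] -/
theorem tendsto_cofinite_sub_atoms (hν : 3 ≤ ν) {N : ℕ} (hN : 1 ≤ N) {m : ℝ} {a : ℕ → ℝ}
    (hb : ∀ k ≤ N, 0 ≤ fluctCoeff N a k) (hev : ∀ n, Even (Ls n)) (hLs : Tendsto Ls atTop atTop)
    {T : Site ν → ℝ}
    (hT : ∀ x, Tendsto (fun n => corrFn (L := Ls n) N m a (Torus.proj (Ls n) x)) atTop (nhds (T x)))
    {c c' : ℝ} (hc : Tendsto (fun n => zeroMode (ν := ν) (L := Ls n) N m a) atTop (nhds c))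
    (hc' : Tendsto (fun n => stagMode (ν := ν) (L := Ls n) (hev n).two_dvd N m a) atTop (nhds c')) :
    Tendsto (fun x => T x - c - c' * latSgn x) cofinite (nhds 0) := by
  classical
  have hν1 : 1 ≤ ν := by omega
  have hNpos : (0 : ℝ) < N := by exact_mod_cast hN
  set R : Site ν → ℝ := fun x => T x - c - c' * latSgn x with hR
  rw [Metric.tendsto_nhds]
  intro ε hε
  obtain ⟨η, hη, hnl⟩ := exists_nearLimit_le (ν := ν) hν hN (δ := ε / 3) (by positivity)
  -- the near bounds converge to `nearLimit`
  have hnb : Tendsto (fun n => nearBound ν (Ls n) η N) atTop (nhds (nearLimit ν η N)) := by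
    rw [Metric.tendsto_nhds]
    intro δ hδ
    obtain ⟨L₀, hL₀⟩ := nearBound_tendsto (ν := ν) hν hη hN (δ := δ / 2) (by positivity)
    filter_upwards [hLs.eventually_ge_atTop L₀] with n hn
    rw [Real.dist_eq]
    exact lt_of_le_of_lt (hL₀ (Ls n) (hev n) hn) (by linarith)
  -- the uniform `ℓ²` bound passes to the limit on every finite set of sites
  have hsq : ∀ B : Finset (Site ν),
      ∑ x ∈ B, (max (|R x| - nearLimit ν η N) 0) ^ 2 ≤ (1 / (2 * N * η)) ^ 2 := by
    intro B
    obtain ⟨L₁, hL₁⟩ := exists_injOn_proj B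
    -- the finite-volume sums converge to the limit sum
    have hlim : Tendsto (fun n => ∑ x ∈ B,
        (max (|corrFn (L := Ls n) N m a (Torus.proj (Ls n) x) - zeroMode (ν := ν) (L := Ls n) N m a -
          stagMode (ν := ν) (L := Ls n) (hev n).two_dvd N m a * sgn (hev n).two_dvd (Torus.proj (Ls n) x)|
          - nearBound ν (Ls n) η N) 0) ^ 2) atTop
        (nhds (∑ x ∈ B, (max (|R x| - nearLimit ν η N) 0) ^ 2)) := by
      refine tendsto_finsetSum _ fun x _ => ?_
      have hx : Tendsto (fun n => corrFn (L := Ls n) N m a (Torus.proj (Ls n) x) -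
          zeroMode (ν := ν) (L := Ls n) N m a -
          stagMode (ν := ν) (L := Ls n) (hev n).two_dvd N m a * sgn (hev n).two_dvd (Torus.proj (Ls n) x))
          atTop (nhds (R x)) := by
        simp_rw [sgn_proj]
        exact ((hT x).sub hc).sub (hc'.mul_const _)
      exact ((hx.abs.sub hnb).max tendsto_const_nhds).pow 2
    refine le_of_tendsto hlim ?_
    filter_upwards [hLs.eventually_ge_atTop (max L₁ 2)] with n hn
    have hn1 : L₁ ≤ Ls n := le_trans (le_max_left _ _) hn
    have hn2 : 2 ≤ Ls n := le_trans (le_max_right _ _) hn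
    have hcard : 2 ≤ Fintype.card (TorusSite ν (Ls n)) := by
      rw [card_torusSite]
      calc 2 ≤ Ls n := hn2
        _ = Ls n ^ 1 := (pow_one _).symm
        _ ≤ Ls n ^ ν := Nat.pow_le_pow_right (by omega) hν1
    rw [← Finset.sum_image (f := fun ξ : TorusSite ν (Ls n) =>
      (max (|corrFn N m a ξ - zeroMode (ν := ν) (L := Ls n) N m a -
        stagMode (ν := ν) (L := Ls n) (hev n).two_dvd N m a * sgn (hev n).two_dvd ξ|
        - nearBound ν (Ls n) η N) 0) ^ 2) (fun x hx y hy hxy => hL₁ (Ls n) hn1 hx hy hxy)]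
    exact sum_sq_posPart_remainder_le (hev n) hν1 ⟨0, hν1⟩ hcard hN m hb hη _
  -- hence `|R| ≤ nearLimit + ε/3 ≤ 2ε/3 < ε` cofinitely
  have hev' := eventually_abs_le_of_sum_sq_le hsq (δ := ε / 3) (by positivity)
  filter_upwards [hev'] with x hx
  rw [Real.dist_eq, sub_zero]
  linarith

/-- **Theorem 3.23 (1), lattice form: every thermodynamic limit of the two-point function is
"two Dirac masses plus a Riemann–Lebesgue remainder".**  Let `ν ≥ 3`, `N ≥ 1`, `b_k ≥ 0` (`k ≤ N`,
the hypothesis of the infrared bound Thm. 3.21), and let `Λ_n = (ℤ/L_n)^ν` be even tori with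
`L_n → ∞` along which `|T_{Λ_n}| ≤ 1` and `T_{Λ_n}(x) → T(x)` for every `x ∈ ℤ^ν`.  Then there are
`c₀ ≥ 0` and `c_π̂ ≥ 0` such that
* the atoms converge: `|Λ_n|⁻¹ T̂_{Λ_n}(0) → c₀` and `|Λ_n|⁻¹ T̂_{Λ_n}(π̂) → -c_π̂`;
* `T(x) - (c₀ - c_π̂ ε(x)) → 0` as `|x| → ∞`.
In the language of the print: `T̂ = c₀ δ₀ - c_π̂ δ_π̂ + ĝ` with `ĝ` absolutely continuous
((3.108); here: its lattice Fourier transform vanishes at infinity), `c₀, c_π̂ ≥ 0` by the peaking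
argument ((3.112) at `k = π̂` resp. its mirror image at `k = 0`).  The density bounds (3.109) on `ĝ`
are represented by their finite-volume form `twoPtHat_mode_le`/`neg_twoPtHat_mode_le`.
[cite: SalmhoferSeiler1991, Thm. 3.23 (1) (3.107)–(3.108)] -/
theorem thermodynamicLimit_twoPoint_decomp (hν : 3 ≤ ν) {N : ℕ} (hN : 1 ≤ N) {m : ℝ} {a : ℕ → ℝ}
    (hb : ∀ k ≤ N, 0 ≤ fluctCoeff N a k) (hev : ∀ n, Even (Ls n)) (hLs : Tendsto Ls atTop atTop)
    {T : Site ν → ℝ}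
    (hT : ∀ x, Tendsto (fun n => corrFn (L := Ls n) N m a (Torus.proj (Ls n) x)) atTop (nhds (T x)))
    (hT1 : ∀ n (x : TorusSite ν (Ls n)), |corrFn N m a x| ≤ 1) :
    ∃ c₀ cπ : ℝ, 0 ≤ c₀ ∧ 0 ≤ cπ ∧
      Tendsto (fun n => zeroMode (ν := ν) (L := Ls n) N m a) atTop (nhds c₀) ∧
      Tendsto (fun n => stagMode (ν := ν) (L := Ls n) (hev n).two_dvd N m a) atTop (nhds (-cπ)) ∧
      Tendsto (fun x => T x - (c₀ - cπ * latSgn x)) cofinite (nhds 0) := by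
  classical
  have hν1 : 1 ≤ ν := by omega
  have hNpos : (0 : ℝ) < N := by exact_mod_cast hN
  have hνpos : (0 : ℝ) < ν := by exact_mod_cast hν1
  -- the pair of atoms as a bounded sequence in `ℝ × ℝ`
  set u : ℕ → ℝ × ℝ := fun n => (zeroMode (ν := ν) (L := Ls n) N m a,
    stagMode (ν := ν) (L := Ls n) (hev n).two_dvd N m a) with hu
  have hubdd : ∀ n, u n ∈ Metric.closedBall (0 : ℝ × ℝ) 1 := by
    intro n
    rw [Metric.mem_closedBall, dist_zero_right, Prod.norm_def, max_le_iff]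
    exact ⟨by rw [Real.norm_eq_abs]; exact abs_zeroMode_le_one (hT1 n),
      by rw [Real.norm_eq_abs]; exact abs_stagMode_le_one _ (hT1 n)⟩
  -- general facts about subsequences `ns → ∞`
  have hsub : ∀ ns : ℕ → ℕ, Tendsto ns atTop atTop →
      ∃ ms : ℕ → ℕ, StrictMono ms ∧ ∃ p : ℝ × ℝ, Tendsto (fun k => u (ns (ms k))) atTop (nhds p) ∧
        Tendsto (fun x => T x - p.1 - p.2 * latSgn x) cofinite (nhds 0) := by
    intro ns hns
    obtain ⟨p, -, ms, hms, hlim⟩ := tendsto_subseq_of_bounded (Metric.isBounded_closedBall)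
      (x := fun k => u (ns k)) (fun k => hubdd (ns k))
    refine ⟨ms, hms, p, hlim, ?_⟩
    haveI : ∀ k, NeZero (Ls (ns (ms k))) := fun k => inferInstance
    have hlim1 : Tendsto (fun k => zeroMode (ν := ν) (L := Ls (ns (ms k))) N m a) atTop (nhds p.1) :=
      (continuous_fst.tendsto p).comp hlim
    have hlim2 : Tendsto (fun k => stagMode (ν := ν) (L := Ls (ns (ms k)))
        (hev (ns (ms k))).two_dvd N m a) atTop (nhds p.2) :=
      (continuous_snd.tendsto p).comp hlim
    exact tendsto_cofinite_sub_atoms (fun k => Ls (ns (ms k))) hν hN hb (fun k => hev (ns (ms k)))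
      (hLs.comp (hns.comp hms.tendsto_atTop)) (fun x => (hT x).comp (hns.comp hms.tendsto_atTop))
      hlim1 hlim2
  -- one subsequential limit `p₀`
  obtain ⟨ms₀, hms₀, p₀, hp₀, hR₀⟩ := hsub id tendsto_id
  -- every subsequential limit equals `p₀`
  have huniq : ∀ p : ℝ × ℝ, Tendsto (fun x => T x - p.1 - p.2 * latSgn x) cofinite (nhds 0) →
      p = p₀ := by
    intro p hp
    have hdiff : Tendsto (fun x : Site ν => (p₀.1 - p.1) + (p₀.2 - p.2) * latSgn x) cofinite
        (nhds 0) := by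
      have := hp.sub hR₀
      rw [sub_zero] at this
      refine this.congr fun x => ?_
      ring
    obtain ⟨h1, h2⟩ := eq_zero_of_tendsto_const_add_mul_latSgn hν1 hdiff
    ext <;> linarith
  -- hence the whole sequence converges to `p₀`
  have hconv : Tendsto u atTop (nhds p₀) := by
    refine tendsto_of_subseq_tendsto fun ns hns => ?_
    obtain ⟨ms, -, p, hp, hRp⟩ := hsub ns hns
    rw [huniq p hRp] at hp
    exact ⟨ms, hp⟩
  have hc : Tendsto (fun n => zeroMode (ν := ν) (L := Ls n) N m a) atTop (nhds p₀.1) :=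
    (continuous_fst.tendsto p₀).comp hconv
  have hc' : Tendsto (fun n => stagMode (ν := ν) (L := Ls n) (hev n).two_dvd N m a) atTop (nhds p₀.2) :=
    (continuous_snd.tendsto p₀).comp hconv
  -- signs of the atoms from the infrared bound at `k = 0` and `k = π̂`
  have hcard_inv := tendsto_card_inv Ls hν1 hLs
  have h2 : ∀ᶠ n in atTop, 2 ≤ Fintype.card (TorusSite ν (Ls n)) := by
    filter_upwards [hLs.eventually_ge_atTop 2] with n hn
    rw [card_torusSite]
    calc 2 ≤ Ls n := hn
      _ = Ls n ^ 1 := (pow_one _).symm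
      _ ≤ Ls n ^ ν := Nat.pow_le_pow_right (by omega) hν1
  have hc0 : 0 ≤ p₀.1 := by
    have hlow : Tendsto (fun n => -((Fintype.card (TorusSite ν (Ls n)) : ℝ)⁻¹ * (1 / (4 * ν * N))))
        atTop (nhds 0) := by
      have := (hcard_inv.mul_const (1 / (4 * (ν : ℝ) * N))).neg
      simpa using this
    refine le_of_tendsto_of_tendsto hlow hc ?_
    filter_upwards [h2] with n hn
    exact neg_le_zeroMode (hev n) hν1 ⟨0, hν1⟩ hn hN m hb
  have hcπ : p₀.2 ≤ 0 := by
    have hup : Tendsto (fun n => (Fintype.card (TorusSite ν (Ls n)) : ℝ)⁻¹ * (1 / (4 * ν * N)))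
        atTop (nhds 0) := by
      have := hcard_inv.mul_const (1 / (4 * (ν : ℝ) * N))
      simpa using this
    refine le_of_tendsto_of_tendsto hc' hup ?_
    filter_upwards [h2] with n hn
    exact stagMode_le (hev n) hν1 ⟨0, hν1⟩ hn hN m hb
  refine ⟨p₀.1, -p₀.2, hc0, by linarith, hc, by rw [neg_neg]; exact hc', ?_⟩
  refine hR₀.congr fun x => ?_
  ring

end Limit

section Limit2

variable (Ls : ℕ → ℕ) [∀ n, NeZero (Ls n)]

/-- Even and nonzero ⇒ `≥ 2`. [folklore] -/
private theorem two_le_of_even {L : ℕ} [NeZero L] (hL : Even L) : 2 ≤ L := by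
  have := NeZero.ne L
  obtain ⟨k, hk⟩ := hL
  omega

/-- **Theorem 3.23 (1) under the hypotheses of Theorem 3.18** (`B = exp(NW)` to order `N`, `w₁ = 1`,
`w_k ≥ 0`, `m ≥ 0`; then `b_k ≥ 0` and `0 ≤ T_Λ ≤ 1` are theorems of the tree): every thermodynamic
limit `T` of the two-point function along even tori `Λ_n → ∞` satisfies
`T(x) - (c₀ - c_π̂ ε(x)) → 0` (`|x| → ∞`) with `c₀ = lim |Λ_n|⁻¹ T̂_{Λ_n}(0) ≥ 0`,
`-c_π̂ = lim |Λ_n|⁻¹ T̂_{Λ_n}(π̂)`, `c_π̂ ≥ 0`. [cite: SalmhoferSeiler1991, Thm. 3.23 (1) with Thm. 3.18] -/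
theorem thermodynamicLimit_twoPoint_decomp_of_hasLog (hν : 3 ≤ ν) {N : ℕ} (hN : 1 ≤ N)
    {a w : ℕ → ℝ} (hlog : HasLog N a w) (ha0 : a 0 = 1) (hw1 : w 1 = 1)
    (hw : ∀ k, 2 ≤ k → k ≤ N → 0 ≤ w k) {m : ℝ} (hm : 0 ≤ m)
    (hev : ∀ n, Even (Ls n)) (hLs : Tendsto Ls atTop atTop) {T : Site ν → ℝ}
    (hT : ∀ x, Tendsto (fun n => corrFn (L := Ls n) N m a (Torus.proj (Ls n) x)) atTop (nhds (T x))) :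
    ∃ c₀ cπ : ℝ, 0 ≤ c₀ ∧ 0 ≤ cπ ∧
      Tendsto (fun n => zeroMode (ν := ν) (L := Ls n) N m a) atTop (nhds c₀) ∧
      Tendsto (fun n => stagMode (ν := ν) (L := Ls n) (hev n).two_dvd N m a) atTop (nhds (-cπ)) ∧
      Tendsto (fun x => T x - (c₀ - cπ * latSgn x)) cofinite (nhds 0) :=
  thermodynamicLimit_twoPoint_decomp Ls hν hN (fluctCoeff_nonneg_of_hasLog hlog ha0 hw1 hw) hev hLs hT
    fun n x => by
      have h := corrFn_mem_Icc (by omega) (hev n) (two_le_of_even (hev n)) hN hlog ha0 hw1 hw hm x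
      rw [abs_le]
      exact ⟨by linarith [h.1], h.2⟩

/-- `ε(x) = 1` iff `∑ x_μ` is even. [cite: SalmhoferSeiler1991, (2.8)] -/
private theorem latSgn_eq_one_iff (x : Site ν) : latSgn x = 1 ↔ Even (∑ i, x i) := by
  unfold latSgn
  constructor
  · intro h; by_contra hne; rw [if_neg hne] at h; norm_num at h
  · intro h; rw [if_pos h]

/-- **Theorem 4.8 (4.42) and Remark 4.10 (1) (4.43): chiral long-range order IN THE THERMODYNAMIC
LIMIT.**  Let `ν ≥ 3`, `B = exp(NW)` to order `N` with `w₁ = 1`, `w_k ≥ 0` (Thm. 4.8's hypotheses),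
`m = 0`, and let `T` be any thermodynamic limit of the two-point function `T_Λ(x) = ⟨σ₀σ_x⟩_Λ` along
even tori `Λ_n → ∞`.  Then, with `c₀ = lim_n |Λ_n|⁻¹ ∑_x ⟨σ₀σ_x⟩_{Λ_n}` (the Dirac mass of `T̂` at
`k = 0`, `= c_π̂` by chiral symmetry (3.106)):
* `c₀ ≥ (1/4ν)(1/K(N) - 2S(ν)/N)` (4.42);
* `T(x) = 0` on the even sublattice ((3.101));
* `T(x) → 2c₀` as `|x| → ∞` along the odd sublattice, and `limsup_{x ∈ ℤ^ν} T(x) = 2c₀` (4.43).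
So `T` does not decay whenever `2S(ν)K(N)/N < 1` ("`ν ≥ ν₀`"): long-range order at `m = 0`.
[cite: SalmhoferSeiler1991, Thm. 4.8 (4.42) and Remark 4.10 (1) (4.43)] -/
theorem chiralLRO_thermodynamicLimit (hν : 3 ≤ ν) {N : ℕ} (hN : 1 ≤ N)
    {a w : ℕ → ℝ} (hlog : HasLog N a w) (ha0 : a 0 = 1) (hw1 : w 1 = 1)
    (hw : ∀ k, 2 ≤ k → k ≤ N → 0 ≤ w k)
    (hev : ∀ n, Even (Ls n)) (hLs : Tendsto Ls atTop atTop) {T : Site ν → ℝ}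
    (hT : ∀ x, Tendsto (fun n => corrFn (L := Ls n) N 0 a (Torus.proj (Ls n) x)) atTop (nhds (T x))) :
    ∃ c₀ : ℝ,
      1 / (4 * ν) * (1 / sdK N w - 2 * fluctS ν / N) ≤ c₀ ∧ 0 ≤ c₀ ∧
      Tendsto (fun n => zeroMode (ν := ν) (L := Ls n) N 0 a) atTop (nhds c₀) ∧
      Tendsto (fun n => stagMode (ν := ν) (L := Ls n) (hev n).two_dvd N 0 a) atTop (nhds (-c₀)) ∧
      (∀ x, latSgn x = 1 → T x = 0) ∧
      Tendsto T (cofinite ⊓ 𝓟 {x | latSgn x = -1}) (nhds (2 * c₀)) ∧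
      (∀ ε, 0 < ε → ∀ᶠ x in cofinite, T x ≤ 2 * c₀ + ε) ∧
      (∀ ε, 0 < ε → ∃ᶠ x in cofinite, 2 * c₀ - ε ≤ T x) ∧
      Filter.limsup T cofinite = 2 * c₀ := by
  classical
  have hν1 : 1 ≤ ν := by omega
  haveI : Infinite (Site ν) := infinite_site hν1
  obtain ⟨c₀, cπ, hc0, hcπ, hc, hc', hR⟩ :=
    thermodynamicLimit_twoPoint_decomp_of_hasLog Ls hν hN hlog ha0 hw1 hw le_rfl hev hLs hT
  -- `c_π̂ = c₀` by (3.106)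
  have hππ : cπ = c₀ := by
    have h1 : Tendsto (fun n => stagMode (ν := ν) (L := Ls n) (hev n).two_dvd N 0 a) atTop
        (nhds (-c₀)) := by
      have := hc.neg
      refine this.congr fun n => ?_
      rw [stagMode_zero_mass (hev n).two_dvd hν1]
    have := tendsto_nhds_unique hc' h1
    linarith
  subst hππ
  -- `T = 0` on the even sublattice, (3.101)
  have heven : ∀ x, latSgn x = 1 → T x = 0 := by
    intro x hx
    have h0 : ∀ n, corrFn (L := Ls n) N 0 a (Torus.proj (Ls n) x) = 0 := fun n =>
      corrFn_zero_mass_eq_zero (hev n).two_dvd hν1 N a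
        ((parity_proj_eq_zero_iff (hev n).two_dvd x).2 ((latSgn_eq_one_iff x).1 hx))
    have := hT x
    simp_rw [h0] at this
    exact tendsto_nhds_unique this tendsto_const_nhds
  -- on the odd sublattice `R = T - 2c₀`
  have hodd : ∀ x, latSgn x = -1 → T x - (cπ - cπ * latSgn x) = T x - 2 * cπ := by
    intro x hx; rw [hx]; ring
  have hTodd : Tendsto T (cofinite ⊓ 𝓟 {x | latSgn x = -1}) (nhds (2 * cπ)) := by
    have h1 : Tendsto (fun x => T x - (cπ - cπ * latSgn x)) (cofinite ⊓ 𝓟 {x | latSgn x = -1})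
        (nhds 0) := hR.mono_left inf_le_left
    have h2 : Tendsto (fun x => T x - 2 * cπ) (cofinite ⊓ 𝓟 {x | latSgn x = -1}) (nhds 0) := by
      refine h1.congr' ?_
      exact eventually_inf_principal.2 (Eventually.of_forall fun x hx => hodd x hx)
    have h3 := h2.add_const (2 * cπ)
    simp only [zero_add, sub_add_cancel] at h3
    exact h3
  -- eventually `T ≤ 2c₀ + ε`
  have hup : ∀ ε, 0 < ε → ∀ᶠ x in cofinite, T x ≤ 2 * cπ + ε := by
    intro ε hε
    filter_upwards [(Metric.tendsto_nhds.1 hR) ε hε] with x hx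
    rw [Real.dist_eq, sub_zero] at hx
    rcases latSgn_eq_one_or x with h1 | h1
    · rw [heven x h1]; linarith
    · rw [hodd x h1] at hx
      have := (abs_lt.1 hx).2
      linarith
  -- frequently `T ≥ 2c₀ - ε`
  have hlow : ∀ ε, 0 < ε → ∃ᶠ x in cofinite, 2 * cπ - ε ≤ T x := by
    intro ε hε
    have hfr : ∃ᶠ x : Site ν in cofinite, latSgn x = -1 :=
      frequently_cofinite_iff_infinite.2 (infinite_latSgn_eq_neg_one hν1)
    refine (hfr.and_eventually ((Metric.tendsto_nhds.1 hR) ε hε)).mono fun x hx => ?_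
    obtain ⟨h1, h2⟩ := hx
    rw [Real.dist_eq, sub_zero, hodd x h1] at h2
    have := (abs_lt.1 h2).1
    linarith
  -- the lower bound (4.42) on `c₀`
  have hbound : 1 / (4 * ν) * (1 / sdK N w - 2 * fluctS ν / N) ≤ cπ := by
    refine le_of_forall_pos_le_add fun ε hε => ?_
    obtain ⟨L₀, hL₀⟩ := chiralLRO_expect_limit (ν := ν) hν hN hlog ha0 hw1 hw hε
    have hevn : ∀ᶠ n in atTop, 1 / (4 * ν) * (1 / sdK N w - 2 * fluctS ν / N) - ε ≤
        zeroMode (ν := ν) (L := Ls n) N 0 a := by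
      filter_upwards [hLs.eventually_ge_atTop L₀] with n hn
      exact hL₀ (Ls n) (hev n) hn
    have := ge_of_tendsto hc hevn
    linarith
  -- the limsup
  have hlimsup : Filter.limsup T cofinite = 2 * cπ := by
    have hT01 : ∀ x, T x ∈ Set.Icc (0 : ℝ) 1 := fun x =>
      isClosed_Icc.mem_of_tendsto (hT x) (Eventually.of_forall fun n =>
        corrFn_mem_Icc hν1 (hev n) (two_le_of_even (hev n)) hN hlog ha0 hw1 hw le_rfl _)
    have hbdd : IsBoundedUnder (· ≤ ·) cofinite T := isBoundedUnder_of ⟨1, fun x => (hT01 x).2⟩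
    have hcobdd : IsCoboundedUnder (· ≤ ·) cofinite T :=
      isCoboundedUnder_le_of_eventually_le cofinite (Eventually.of_forall fun x => (hT01 x).1)
    apply le_antisymm
    · refine le_of_forall_pos_le_add fun ε hε => ?_
      exact limsup_le_of_le hcobdd (hup ε hε)
    · refine le_of_forall_pos_le_add fun ε hε => ?_
      have := le_limsup_of_frequently_le (hlow ε hε) hbdd
      linarith
  exact ⟨cπ, hbound, hc0, hc, hc', heven, hTodd, hup, hlow, hlimsup⟩

/-- **Corollary 4.9 with Remark 4.10 (1), `U(N)`, `N ≤ 4`, `ν ≥ 4` — in the thermodynamic limit and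
WITHOUT numerical hypotheses**: for the `β = 0` `U(N)` lattice gauge theory with massless staggered
fermions in its complex-spin form, every thermodynamic limit `T` of `⟨σ₀σ_x⟩_Λ` along even tori
`Λ_n → ∞` vanishes on the even sublattice and converges along the odd sublattice to
`2c₀ = limsup_x T(x) > 0`, `c₀ = lim |Λ_n|⁻¹∑_x⟨σ₀σ_x⟩_{Λ_n}` (the computer-assisted `S(ν) < 0.35` of
Prop. 4.2 (4) is the tree's kernel certificate `uN_chiralLRO_of_four_le`). [cite: SalmhoferSeiler1991, Cor. 4.9 and Remark 4.10 (1) (4.43)] -/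
theorem uN_chiralLRO_thermodynamicLimit {N : ℕ} (hN1 : 1 ≤ N) (hN4 : N ≤ 4) (hν : 4 ≤ ν)
    (hev : ∀ n, Even (Ls n)) (hLs : Tendsto Ls atTop atTop) {T : Site ν → ℝ}
    (hT : ∀ x, Tendsto (fun n => corrFn (L := Ls n) N 0 (uNBondCoeff N) (Torus.proj (Ls n) x))
      atTop (nhds (T x))) :
    ∃ c₀ : ℝ, 0 < c₀ ∧
      Tendsto (fun n => zeroMode (ν := ν) (L := Ls n) N 0 (uNBondCoeff N)) atTop (nhds c₀) ∧
      (∀ x, latSgn x = 1 → T x = 0) ∧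
      Tendsto T (cofinite ⊓ 𝓟 {x | latSgn x = -1}) (nhds (2 * c₀)) ∧
      Filter.limsup T cofinite = 2 * c₀ := by
  obtain ⟨c₀, -, -, hc, -, heven, hTodd, -, -, hlimsup⟩ :=
    chiralLRO_thermodynamicLimit Ls (by omega) hN1 (hasLog_uN hN1 hN4) (uNBondCoeff_zero N)
      (uNLogCoeff_one N) (fun k hk2 hkN => uNLogCoeff_nonneg hN4 k hk2 hkN) hev hLs hT
  obtain ⟨c, hcpos, L₀, hL₀⟩ := uN_chiralLRO_of_four_le (ν := ν) hN1 hN4 hν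
  have hevn : ∀ᶠ n in atTop, c ≤ zeroMode (ν := ν) (L := Ls n) N 0 (uNBondCoeff N) := by
    filter_upwards [hLs.eventually_ge_atTop L₀] with n hn
    exact hL₀ (Ls n) (hev n) hn
  have hc0 : c ≤ c₀ := ge_of_tendsto hc hevn
  exact ⟨c₀, lt_of_lt_of_le hcpos hc0, hc, heven, hTodd, hlimsup⟩

/-! ### Existence of thermodynamic limits of the two-point function (Thm. 3.18 (2)) -/

/-- The two-point observable read through the projection: `σ^{δ₀+δ_x}` on `Λ_n` is `σ₀σ_{x mod L}`.
[cite: SalmhoferSeiler1991, Thm. 3.18 (2)] -/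
private theorem monomial_proj_pair (L : ℕ) [NeZero L] (x : Site ν) :
    (monomial (Finsupp.mapDomain (Torus.proj L) (Finsupp.single (0 : Site ν) 1 + Finsupp.single x 1))
      (1 : ℝ) : MvPolynomial (TorusSite ν L) ℝ) = X 0 * X (Torus.proj L x) := by
  rw [Finsupp.mapDomain_add, Finsupp.mapDomain_single, Finsupp.mapDomain_single, torus_proj_zero,
    X, X, monomial_mul, mul_one]

/-- **Theorem 3.18 (2) for the two-point function**: along a subsequence of any sequence of even
tori, `T_Λ(x) → T(x)` for every `x ∈ ℤ^ν`. [cite: SalmhoferSeiler1991, Thm. 3.18 (2) (3.60)] -/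
theorem exists_subseq_tendsto_corrFn (hν : 1 ≤ ν) {N : ℕ} (hN : 1 ≤ N) {a w : ℕ → ℝ}
    (hlog : HasLog N a w) (ha0 : a 0 = 1) (hw1 : w 1 = 1) (hw : ∀ k, 2 ≤ k → k ≤ N → 0 ≤ w k)
    {m : ℝ} (hm : 0 ≤ m) (hev : ∀ n, Even (Ls n)) :
    ∃ φ : ℕ → ℕ, StrictMono φ ∧ ∃ T : Site ν → ℝ, ∀ x,
      Tendsto (fun n => corrFn (L := Ls (φ n)) N m a (Torus.proj (Ls (φ n)) x)) atTop (nhds (T x)) := by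
  obtain ⟨φ, hφ, c, hc⟩ := exists_subseq_tendsto_expect hν hN hlog ha0 hw1 hw hm Ls hev
    fun n => two_le_of_even (hev n)
  refine ⟨φ, hφ, fun x => c (Finsupp.single 0 1 + Finsupp.single x 1), fun x => ?_⟩
  have h := (hc (Finsupp.single 0 1 + Finsupp.single x 1)).2
  simp_rw [monomial_proj_pair] at h
  exact h

/-- **Corollary 4.9 and Remark 4.10 (1) AS PRINTED (`U(N)`, `N ≤ 4`, `ν ≥ 4`)**: for every sequence
of even tori `Λ_n = (ℤ/L_n)^ν`, `L_n → ∞`, there are a subsequence and a thermodynamic limit `T` of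
the `m = 0` two-point function `⟨σ₀σ_x⟩_Λ = ⟨(ψ̄ψ(0)/2N)(ψ̄ψ(x)/2N)⟩_Λ` of the `β = 0` `U(N)` theory
with massless staggered fermions (bosonised form, (2.21)), and for EVERY such limit
`lim_{|x|→∞, ε(x)=-1} T(x) = limsup_x T(x) = 2c₀ > 0` (4.43) while `T = 0` on the even sublattice:
chiral long-range order in the infinite volume.  Honest scope: `β = 0`, finite even tori and their
pointwise limits; the identification with the gauge theory is `StrongCouplingBosonisation`
(`fermiExpect_spinObs`); nothing about `β > 0`, the continuum or `SU(N)`.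
[cite: SalmhoferSeiler1991, Cor. 4.9 and Remark 4.10 (1) (4.43)] -/
theorem uN_chiralLRO_infiniteVolume {N : ℕ} (hN1 : 1 ≤ N) (hN4 : N ≤ 4) (hν : 4 ≤ ν)
    (hev : ∀ n, Even (Ls n)) (hLs : Tendsto Ls atTop atTop) :
    (∃ φ : ℕ → ℕ, StrictMono φ ∧ ∃ T : Site ν → ℝ, ∀ x,
      Tendsto (fun n => corrFn (L := Ls (φ n)) N 0 (uNBondCoeff N) (Torus.proj (Ls (φ n)) x))
        atTop (nhds (T x))) ∧
    (∀ (φ : ℕ → ℕ), StrictMono φ → ∀ T : Site ν → ℝ,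
      (∀ x, Tendsto (fun n => corrFn (L := Ls (φ n)) N 0 (uNBondCoeff N) (Torus.proj (Ls (φ n)) x))
        atTop (nhds (T x))) →
      ∃ c₀ : ℝ, 0 < c₀ ∧ (∀ x, latSgn x = 1 → T x = 0) ∧
        Tendsto T (cofinite ⊓ 𝓟 {x | latSgn x = -1}) (nhds (2 * c₀)) ∧
        Filter.limsup T cofinite = 2 * c₀) := by
  refine ⟨exists_subseq_tendsto_corrFn Ls (by omega) hN1 (hasLog_uN hN1 hN4) (uNBondCoeff_zero N)
    (uNLogCoeff_one N) (fun k hk2 hkN => uNLogCoeff_nonneg hN4 k hk2 hkN) le_rfl hev, ?_⟩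
  intro φ hφ T hT
  haveI : ∀ n, NeZero (Ls (φ n)) := fun n => inferInstance
  obtain ⟨c₀, hc0, -, heven, hTodd, hlimsup⟩ := uN_chiralLRO_thermodynamicLimit (fun n => Ls (φ n))
    hN1 hN4 hν (fun n => hev (φ n)) (hLs.comp hφ.tendsto_atTop) hT
  exact ⟨c₀, hc0, heven, hTodd, hlimsup⟩

end Limit2

end ComplexSpin

end Literature.MathematicalPhysics.StatisticalMechanics

end
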